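import Mathlib
import Summits.Ventures.PercRepro2.HCov
import Summits.Ventures.PercRepro2.A3Inactive
import Summits.Ventures.PercRepro2.BasePendant
import Summits.Ventures.PercRepro2.PendantRoot
import Summits.Ventures.PercRepro2.CCTRootEdge
import Summits.Ventures.PercRepro2.EdgeCubic

/-!
# A pendant edge of `a₃`: the twenty-four masses of the one-edge cubic, the polynomial identities and
the `(b, u)` slack (blind cell PercRepro2, p5 g15; `proofs/P5-OEDGE.md` §15–§16)

Let `a₃` be a LEAF attached to `u` by the edge `f` (`hf : ends f = s(a₃, u)`, `hleaf`). Every event not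
mentioning `a₃` is free of `f` (`PendantRoot.free_connEvent`, `mem_update_iff_of_free`); at `p[f↦0]`
the leaf is isolated (`preimage_false_PD`: `PD` pulls back to `Q`, `preimage_false_T`: `T`, `T′` to `∅`),
at `p[f↦1]` it is identified with `u` (`preimage_true_PD` / `preimage_true_T`: `PD`, `T`, `T′` pull back to
the worlds `PD_u`, `T_u`, `T′_u` of the instance with `a₃ := u`). `prob_zero_*` / `prob_one_*` are the
probability forms; `pins_zero_pendant` / `pins_one_pendant` collect the twelve masses of
`EdgeLine.B1` / `B2` at each pin in the base vocabulary.

`B1Poly_pendant` / `B2Poly_pendant` (pure `ring`):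
  `Q·D·B1Poly = Q·D·Gc₀ + D²·Gc₀ + Q²·Gc₁ + Q·(Qo·D − Q·Do)·(Ŝ − D·Qb)`,
  `Q·D·B2Poly = Q·D·Gc₁ + D²·Gc₀ + Q²·Gc₁ + Q·(Qo·D − Q·Do)·(Ŝ − D·Qb)`,
and `slack_nonneg`: `Ŝ − D_u·Qb = Q·EQb3_u + gap·EQ3_u + Q·PDb_u − D_u·Qb = 2 [S(bL, uH) + S(bH, uL)] ≥ 0`
(BHK06 Thm 1.4 twice, `A3Inactive.bLoH_mul_Q_le` / `bHoL_mul_Q_le`). The consequences for `B1`, `B2`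
are in PendantA3Bern.lean.
-/

namespace Summit.Ventures.PercRepro2

open UnionCluster CovForm PendantRoot

namespace PendantA3

section Preimage

variable {V : Type*} {E : Type*} [Fintype E] [DecidableEq E] {R : Type*} [Field R]
  [LinearOrder R] [IsStrictOrderedRing R]

variable {ends : E → Sym2 V} {f : E} {a₃ u : V}

omit [Fintype E] in
/-- A free event does not see the pin of `f`. -/
lemma mem_update_iff_of_free {X : Set (Config E)} (hX : Free f X) (ω : Config E) (c : Bool) :
    Function.update ω f c ∈ X ↔ ω ∈ X := by
  refine dependsOn_mem_iff hX fun e he => ?_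
  have hne : e ≠ f := by simpa using he
  rw [Function.update_of_ne hne]

omit [Fintype E] in
/-- With `f` closed the leaf `a₃` is joined to no other vertex. -/
lemma not_conn_update_false (hf : ends f = s(a₃, u)) (hleaf : ∀ e, a₃ ∈ ends e → e = f)
    (h3u : a₃ ≠ u) (ω : Config E) {x : V} (hx : x ≠ a₃) :
    ¬ Conn ends (Function.update ω f false) x a₃ := by
  intro h
  have hωf : Function.update ω f false f = false := by simp
  exact hx (conn_leaf_closed hf hleaf h3u hωf (conn_symm h))

omit [Fintype E] in
/-- With `f` open the leaf `a₃` is joined to exactly what `u` is joined to (the other vertex `≠ a₃`). -/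
lemma conn_update_true_iff (hf : ends f = s(a₃, u)) (hleaf : ∀ e, a₃ ∈ ends e → e = f)
    (h3u : a₃ ≠ u) (ω : Config E) {x : V} (hx : x ≠ a₃) :
    Conn ends (Function.update ω f true) x a₃ ↔ Conn ends ω x u := by
  have hωf : Function.update ω f true f = true := by simp
  have key := conn_leaf_open (ω := Function.update ω f true) hf hωf (v := x)
  have hfree : Free f (connEvent ends x u) := free_connEvent hf hleaf h3u hx (Ne.symm h3u)
  have hmem := mem_update_iff_of_free hfree ω true
  simp only [mem_connEvent] at hmem
  constructor
  · intro h
    exact hmem.1 (conn_symm (key.1 (conn_symm h)))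
  · intro h
    exact conn_symm (key.2 (conn_symm (hmem.2 h)))

variable (a₁ a₂ : V)

omit [Fintype E] [DecidableEq E] in
/-- `Q` is free of the leaf edge. -/
lemma free_Q (hf : ends f = s(a₃, u)) (hleaf : ∀ e, a₃ ∈ ends e → e = f) (h3u : a₃ ≠ u)
    (h13 : a₁ ≠ a₃) (h23 : a₂ ≠ a₃) : Free f (avoidAll ends a₂ {a₁}) := by
  rw [avoidAll_eq_compl]
  exact (free_connEvent hf hleaf h3u h13 h23).compl

omit [Fintype E] in
/-- Pinned closed: `PD ∩ X` pulls back to `Q ∩ X`. -/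
lemma preimage_false_PD (hf : ends f = s(a₃, u)) (hleaf : ∀ e, a₃ ∈ ends e → e = f) (h3u : a₃ ≠ u)
    (h13 : a₁ ≠ a₃) (h23 : a₂ ≠ a₃) {X : Set (Config E)} (hX : Free f X) :
    {ω : Config E | Function.update ω f false ∈ PDEvent ends a₁ a₂ a₃ ∩ X} =
      avoidAll ends a₂ {a₁} ∩ X := by
  ext ω
  have hQ := mem_update_iff_of_free (free_Q a₁ a₂ hf hleaf h3u h13 h23) ω false
  have hXm := mem_update_iff_of_free hX ω false
  simp only [Set.mem_setOf_eq, Set.mem_inter_iff, PDEvent, Dtilde, Set.mem_compl_iff, mem_inU,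
    mem_connEvent] at hQ ⊢
  simp only [mem_avoidAll, Finset.mem_singleton, forall_eq] at hQ ⊢
  constructor
  · rintro ⟨⟨h12, _⟩, hx⟩
    exact ⟨hQ.1 (fun h => h12 (conn_symm h)), hXm.1 hx⟩
  · rintro ⟨h21, hx⟩
    refine ⟨⟨fun h => (hQ.2 h21) (conn_symm h), ?_⟩, hXm.2 hx⟩
    rintro (h | h)
    · exact not_conn_update_false hf hleaf h3u ω h13 (conn_symm h)
    · exact not_conn_update_false hf hleaf h3u ω h23 (conn_symm h)

omit [Fintype E] in
/-- Pinned closed: `T ∩ X` pulls back to `∅`. -/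
lemma preimage_false_T (hf : ends f = s(a₃, u)) (hleaf : ∀ e, a₃ ∈ ends e → e = f) (h3u : a₃ ≠ u)
    (h23 : a₂ ≠ a₃) (X : Set (Config E)) :
    {ω : Config E | Function.update ω f false ∈ TEvent ends a₁ a₂ a₃ ∩ X} = ∅ := by
  ext ω
  simp only [Set.mem_setOf_eq, Set.mem_inter_iff, TEvent, Set.mem_compl_iff, mem_connEvent,
    Set.mem_empty_iff_false, iff_false, not_and]
  intro h _
  exact not_conn_update_false hf hleaf h3u ω h23 h.2

omit [Fintype E] in
/-- Pinned open: `PD ∩ X` pulls back to `PD_u ∩ X`. -/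
lemma preimage_true_PD (hf : ends f = s(a₃, u)) (hleaf : ∀ e, a₃ ∈ ends e → e = f) (h3u : a₃ ≠ u)
    (h13 : a₁ ≠ a₃) (h23 : a₂ ≠ a₃) {X : Set (Config E)} (hX : Free f X) :
    {ω : Config E | Function.update ω f true ∈ PDEvent ends a₁ a₂ a₃ ∩ X} =
      PDEvent ends a₁ a₂ u ∩ X := by
  ext ω
  have h12 := mem_update_iff_of_free (free_connEvent hf hleaf h3u h13 h23) ω true
  have hXm := mem_update_iff_of_free hX ω true
  have c1 := conn_update_true_iff hf hleaf h3u ω h13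
  have c2 := conn_update_true_iff hf hleaf h3u ω h23
  simp only [mem_connEvent] at h12
  simp only [Set.mem_setOf_eq, Set.mem_inter_iff, PDEvent, Dtilde, Set.mem_compl_iff, mem_inU,
    mem_connEvent]
  constructor
  · rintro ⟨⟨hQ, hU⟩, hx⟩
    refine ⟨⟨fun h => hQ (h12.2 h), ?_⟩, hXm.1 hx⟩
    rintro (h | h)
    · exact hU (Or.inl (conn_symm (c1.2 (conn_symm h))))
    · exact hU (Or.inr (conn_symm (c2.2 (conn_symm h))))
  · rintro ⟨⟨hQ, hU⟩, hx⟩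
    refine ⟨⟨fun h => hQ (h12.1 h), ?_⟩, hXm.2 hx⟩
    rintro (h | h)
    · exact hU (Or.inl (conn_symm (c1.1 (conn_symm h))))
    · exact hU (Or.inr (conn_symm (c2.1 (conn_symm h))))

omit [Fintype E] in
/-- Pinned open: `T ∩ X` pulls back to `T_u ∩ X`. -/
lemma preimage_true_T (hf : ends f = s(a₃, u)) (hleaf : ∀ e, a₃ ∈ ends e → e = f) (h3u : a₃ ≠ u)
    (h13 : a₁ ≠ a₃) (h23 : a₂ ≠ a₃) {X : Set (Config E)} (hX : Free f X) :
    {ω : Config E | Function.update ω f true ∈ TEvent ends a₁ a₂ a₃ ∩ X} =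
      TEvent ends a₁ a₂ u ∩ X := by
  ext ω
  have h21 := mem_update_iff_of_free (free_connEvent hf hleaf h3u h23 h13) ω true
  have hXm := mem_update_iff_of_free hX ω true
  have c2 := conn_update_true_iff hf hleaf h3u ω h23
  simp only [mem_connEvent] at h21
  simp only [Set.mem_setOf_eq, Set.mem_inter_iff, TEvent, Set.mem_compl_iff, mem_connEvent]
  constructor
  · rintro ⟨⟨hQ, h23'⟩, hx⟩
    exact ⟨⟨fun h => hQ (h21.2 h), c2.1 h23'⟩, hXm.1 hx⟩
  · rintro ⟨⟨hQ, h23'⟩, hx⟩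
    exact ⟨⟨fun h => hQ (h21.1 h), c2.2 h23'⟩, hXm.2 hx⟩

omit [Fintype E] in
/-- Either pin: `Q ∩ X` pulls back to itself. -/
lemma preimage_Q (hf : ends f = s(a₃, u)) (hleaf : ∀ e, a₃ ∈ ends e → e = f) (h3u : a₃ ≠ u)
    (h13 : a₁ ≠ a₃) (h23 : a₂ ≠ a₃) {X : Set (Config E)} (hX : Free f X) (c : Bool) :
    {ω : Config E | Function.update ω f c ∈ avoidAll ends a₂ {a₁} ∩ X} =
      avoidAll ends a₂ {a₁} ∩ X := by
  ext ω
  have hQ := mem_update_iff_of_free (free_Q a₁ a₂ hf hleaf h3u h13 h23) ω c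
  have hXm := mem_update_iff_of_free hX ω c
  simp only [Set.mem_setOf_eq, Set.mem_inter_iff]
  exact and_congr hQ hXm

end Preimage

/-! ## The twenty-four masses of `B1` / `B2` at a pendant edge -/

section Masses

variable {V : Type*} {E : Type*} [Fintype E] [DecidableEq E] {R : Type*} [Field R]

variable (p : E → R) {ends : E → Sym2 V} {f : E} {a₃ u : V} (a₁ a₂ : V)
  (hf : ends f = s(a₃, u)) (hleaf : ∀ e, a₃ ∈ ends e → e = f) (h3u : a₃ ≠ u)
  (h13 : a₁ ≠ a₃) (h23 : a₂ ≠ a₃)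

include hf hleaf h3u h13 h23

open CCT

/-- Pinned closed: `P(PD ∩ X) = P(Q ∩ X)` for a free `X`. -/
lemma prob_zero_PD {X : Set (Config E)} (hX : Free f X) :
    prob (Function.update p f 0) (PDEvent ends a₁ a₂ a₃ ∩ X) =
      prob p (avoidAll ends a₂ {a₁} ∩ X) := by
  rw [prob_update_zero_eq, preimage_false_PD a₁ a₂ hf hleaf h3u h13 h23 hX]

omit h13 in
/-- Pinned closed: `P(T ∩ X) = 0`. -/
lemma prob_zero_T (X : Set (Config E)) :
    prob (Function.update p f 0) (TEvent ends a₁ a₂ a₃ ∩ X) = 0 := by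
  rw [prob_update_zero_eq, preimage_false_T a₁ a₂ hf hleaf h3u h23 X, prob_empty]

omit h23 in
/-- Pinned closed: `P(T′ ∩ X) = 0`. -/
lemma prob_zero_T' (X : Set (Config E)) :
    prob (Function.update p f 0) (TEvent ends a₂ a₁ a₃ ∩ X) = 0 := by
  rw [prob_update_zero_eq, preimage_false_T a₂ a₁ hf hleaf h3u h13 X, prob_empty]

/-- Pinned open: `P(PD ∩ X) = P(PD_u ∩ X)`. -/
lemma prob_one_PD {X : Set (Config E)} (hX : Free f X) :
    prob (Function.update p f 1) (PDEvent ends a₁ a₂ a₃ ∩ X) =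
      prob p (PDEvent ends a₁ a₂ u ∩ X) := by
  rw [prob_update_one_eq, preimage_true_PD a₁ a₂ hf hleaf h3u h13 h23 hX]

/-- Pinned open: `P(T ∩ X) = P(T_u ∩ X)`. -/
lemma prob_one_T {X : Set (Config E)} (hX : Free f X) :
    prob (Function.update p f 1) (TEvent ends a₁ a₂ a₃ ∩ X) =
      prob p (TEvent ends a₁ a₂ u ∩ X) := by
  rw [prob_update_one_eq, preimage_true_T a₁ a₂ hf hleaf h3u h13 h23 hX]

/-- Pinned open: `P(T′ ∩ X) = P(T′_u ∩ X)`. -/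
lemma prob_one_T' {X : Set (Config E)} (hX : Free f X) :
    prob (Function.update p f 1) (TEvent ends a₂ a₁ a₃ ∩ X) =
      prob p (TEvent ends a₂ a₁ u ∩ X) := by
  rw [prob_update_one_eq, preimage_true_T a₂ a₁ hf hleaf h3u h23 h13 hX]

/-- Pinned closed: `P(Q ∩ X) = P(Q ∩ X)`. -/
lemma prob_zero_Q {X : Set (Config E)} (hX : Free f X) :
    prob (Function.update p f 0) (avoidAll ends a₂ {a₁} ∩ X) =
      prob p (avoidAll ends a₂ {a₁} ∩ X) := by
  rw [prob_update_zero_eq, preimage_Q a₁ a₂ hf hleaf h3u h13 h23 hX false]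

/-- Pinned open: `P(Q ∩ X) = P(Q ∩ X)`. -/
lemma prob_one_Q {X : Set (Config E)} (hX : Free f X) :
    prob (Function.update p f 1) (avoidAll ends a₂ {a₁} ∩ X) =
      prob p (avoidAll ends a₂ {a₁} ∩ X) := by
  rw [prob_update_one_eq, preimage_Q a₁ a₂ hf hleaf h3u h13 h23 hX true]

end Masses

/-! ## The polynomial identities -/

section Poly

variable {R : Type*} [Field R]

/-- `Q·D·B1Poly = Q·D·Gc₀ + D²·Gc₀ + Q²·Gc₁ + Q·(Qo·D − Q·Do)·(Ŝ − D·Qb)` at a pendant edge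
(the pin-`0` masses collapsed onto `Q, Qo, Qb, Qbo`, the `σ₃`-masses `0`). -/
lemma B1Poly_pendant (Q gap EQbo EQo Qo Qb Qbo D Do EQb3 EQb3o EQ3 EQ3o PDb PDbo : R) :
    Q * D * EdgeLine.B1Poly Q Q Qo EQbo 0 0 EQo 0 0 Qb Qbo gap
        Q D Do EQbo EQb3 EQb3o EQo EQ3 EQ3o PDb PDbo gap =
      Q * D * EdgeLine.GcPoly Q Q Qo EQbo 0 0 EQo 0 0 Qb Qbo gap +
        D * D * EdgeLine.GcPoly Q Q Qo EQbo 0 0 EQo 0 0 Qb Qbo gap +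
        Q * Q * EdgeLine.GcPoly Q D Do EQbo EQb3 EQb3o EQo EQ3 EQ3o PDb PDbo gap +
        Q * (Qo * D - Q * Do) * (Q * EQb3 + gap * EQ3 + Q * PDb - D * Qb) := by
  unfold EdgeLine.B1Poly EdgeLine.GcPoly EdgeLine.polar1
  ring

/-- The `B2` twin: `Q·D·B2Poly = Q·D·Gc₁ + D²·Gc₀ + Q²·Gc₁ + Q·(Qo·D − Q·Do)·(Ŝ − D·Qb)`. -/
lemma B2Poly_pendant (Q gap EQbo EQo Qo Qb Qbo D Do EQb3 EQb3o EQ3 EQ3o PDb PDbo : R) :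
    Q * D * EdgeLine.B2Poly Q Q Qo EQbo 0 0 EQo 0 0 Qb Qbo gap
        Q D Do EQbo EQb3 EQb3o EQo EQ3 EQ3o PDb PDbo gap =
      Q * D * EdgeLine.GcPoly Q D Do EQbo EQb3 EQb3o EQo EQ3 EQ3o PDb PDbo gap +
        D * D * EdgeLine.GcPoly Q Q Qo EQbo 0 0 EQo 0 0 Qb Qbo gap +
        Q * Q * EdgeLine.GcPoly Q D Do EQbo EQb3 EQb3o EQo EQ3 EQ3o PDb PDbo gap +
        Q * (Qo * D - Q * Do) * (Q * EQb3 + gap * EQ3 + Q * PDb - D * Qb) := by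
  unfold EdgeLine.B2Poly EdgeLine.GcPoly EdgeLine.polar2
  ring

end Poly

/-! ## The slack factor is the `(b, u)` BHK slack -/

section Slack

variable {V : Type*} {E : Type*} [Fintype V] [DecidableEq V] [Fintype E] [DecidableEq E]
  {R : Type*} [Field R] [LinearOrder R] [IsStrictOrderedRing R]

omit [Fintype V] [DecidableEq V] [Fintype E] [DecidableEq E] in
/-- `T_u ∩ X = Q ∩ ({u ∈ C₂} ∩ X)`. -/
lemma TEvent_inter_eq (ends : E → Sym2 V) (a₁ a₂ u : V) (X : Set (Config E)) :
    TEvent ends a₁ a₂ u ∩ X = avoidAll ends a₂ {a₁} ∩ (connEvent ends a₂ u ∩ X) := by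
  ext ω
  simp only [TEvent, Set.mem_inter_iff, Set.mem_compl_iff, mem_connEvent, mem_avoidAll,
    Finset.mem_singleton, forall_eq]
  tauto

omit [Fintype V] [DecidableEq V] [Fintype E] [DecidableEq E] in
/-- `T′_u ∩ X = Q ∩ ({u ∈ C₁} ∩ X)`. -/
lemma TEvent'_inter_eq (ends : E → Sym2 V) (a₁ a₂ u : V) (X : Set (Config E)) :
    TEvent ends a₂ a₁ u ∩ X = avoidAll ends a₂ {a₁} ∩ (connEvent ends a₁ u ∩ X) := by
  ext ω
  simp only [TEvent, Set.mem_inter_iff, Set.mem_compl_iff, mem_connEvent, mem_avoidAll,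
    Finset.mem_singleton, forall_eq]
  constructor
  · rintro ⟨⟨h12, hu⟩, hx⟩
    exact ⟨fun h => h12 (conn_symm h), hu, hx⟩
  · rintro ⟨h21, hu, hx⟩
    exact ⟨⟨fun h => h21 (conn_symm h), hu⟩, hx⟩

omit [Fintype V] in
/-- `P(PD_u ∩ X) = P(Q ∩ X) − P(Q, u ∈ C₂, X) − P(Q, u ∈ C₁, X)`. -/
lemma prob_PD_u_inter (p : E → R) (ends : E → Sym2 V) (a₁ a₂ u : V) (X : Set (Config E)) :
    prob p (PDEvent ends a₁ a₂ u ∩ X) =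
      prob p (avoidAll ends a₂ {a₁} ∩ X) -
        prob p (avoidAll ends a₂ {a₁} ∩ (connEvent ends a₂ u ∩ X)) -
        prob p (avoidAll ends a₂ {a₁} ∩ (connEvent ends a₁ u ∩ X)) := by
  have h := Qsplit p ends a₁ a₂ u X
  rw [TEvent_inter_eq, TEvent'_inter_eq] at h
  linarith

/-- **The slack factor is nonnegative**: `Q·EQb3_u + gap·EQ3_u + Q·PDb_u − D_u·Qb ≥ 0` — it equals
`2 [S(bL, uH) + S(bH, uL)]`, the two BHK cross-cluster slacks of the pair `(b, u)`. -/
theorem slack_nonneg (p : E → R) (hp : IsProbVec p) (ends : E → Sym2 V) (a₁ a₂ u b : V) :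
    0 ≤ prob p (avoidAll ends a₂ {a₁}) * EQb3 p ends a₁ a₂ u b +
        gap p ends a₁ a₂ b * EQ3 p ends a₁ a₂ u +
        prob p (avoidAll ends a₂ {a₁}) * PDb p ends a₁ a₂ u b -
        prob p (PDEvent ends a₁ a₂ u) *
          (prob p (avoidAll ends a₂ {a₁} ∩ connEvent ends a₁ b) +
            prob p (avoidAll ends a₂ {a₁} ∩ connEvent ends a₂ b)) := by
  have h1 := A3Inactive.bLoH_mul_Q_le p hp ends u a₁ a₂ b
  have h2 := A3Inactive.bHoL_mul_Q_le p hp ends u a₁ a₂ b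
  have hD := prob_PD_u_inter p ends a₁ a₂ u Set.univ
  have e1 := TEvent_inter_eq ends a₁ a₂ u Set.univ
  have e2 := TEvent'_inter_eq ends a₁ a₂ u Set.univ
  simp only [Set.inter_univ] at hD e1 e2
  unfold EQb3 EQ3 PDb
  rw [gap_eq_Q]
  simp only [prob_PD_u_inter p ends a₁ a₂ u, e1, e2, hD, Set.inter_assoc]
  nlinarith [h1, h2]

end Slack



end PendantA3

end Summit.Ventures.PercRepro2
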